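import Mathlib
import Summits.Ventures.FusionMHD.Models.SAlphaTwoTurnBump
import HarnessLib

/-!
# F3 «F3.BALLOON-sα-TWO-TURN-LENS»: a statement UNIFORM IN THE SHEAR — for EVERY `s ∈ [1/2, 3]` and every `α` between two explicit
# piecewise-linear curves `lensLo s ≤ α ≤ lensHi s`, the surface `(s, α)` of the `s–α` ballooning MODEL is on the UNSTABLE side
# (one compactly supported trial function, model-7's two-turn bump ★ #192, serves the whole polygon)

LADDER-GRIDFUSION rung F3 (cell `gridfusion`; DIRECTOR RULING 67 (5): «a statement uniform in `s` on an interval (a genuinely typed curve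
segment, not a conjunction)» is a row class outside the eight-shear cap).  Statements + proofs by gridfusion-model-7 g9, 2026-08-28, over
model-7 g8's ★ #192 `SAlphaTwoTurnBump` BY NAME (`ttConic`, `tte1_bounds … tte5_bounds`, `unstableWitness_of_ttConic_neg`): the one-surface
energy of the two-turn bump `X = ttX` on `[−2π, 2π]` is the conic `e₁ + e₂s² + e₃sα + e₄α² + e₅α` in `(s, α)`; this file certifies a whole
POLYGON inside its negative region, uniformly in `s`, by pure algebra (no kernel numerics, 0 kit, 0 facts, no `decide`):
* §1 `ttConicHi` — the conic with each `eᵢ` replaced by the rational end of its bracket of record that is worst for `s, α ≥ 0`;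
  `ttConic_le_ttConicHi` (`s, α ≥ 0`);
* §2 two CHORD identities: in `α` at fixed `s` (leading coefficient `3291340 > 0`, so the conic lies below its chord on a segment —
  `ttConicHi_neg_of_between`) and in `s` along a line `α = p + q s` (leading coefficient `3537470 − 6326027 q + 3291340 q²`, checked `≥ 0`
  for each slope used — `ttConicHi_neg_on_line`), reducing negativity on a quadrilateral to its four CORNERS (rational, `norm_num`);
* §3 the polygon: lower polyline `lensLo` through `(1/2, 1/2)`, `(1, 17/25)`, `(3/2, 39/40)`, `(2, 27/20)`, `(5/2, 7/4)`, `(3, 11/5)` (the maximum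
  of its five chords — the data are convex), upper line `lensHi s = 22/25 + (31/25) s`; five piece theorems and
  ★★ `unstableWitness_of_mem_lens : 1/2 ≤ s ≤ 3 → lensLo s ≤ α ≤ lensHi s → SAlpha.UnstableWitness s α (−2π) (2π) ttX ttX′`,
  ★★ `unstableWitness_along_lensLo` (the lower polyline itself is a curve of certified-unstable surfaces).

## THREE COLUMNS
CERTIFIED: in the `s–α` ballooning MODEL (Freidberg (12.96)–(12.99), `Λ = sθ − α sin θ`, `θ₀ = 0`): for EVERY shear `s ∈ [1/2, 3]` and every
`α` with `lensLo s ≤ α ≤ lensHi s` the surface `(s, α)` carries model-7's two-turn-bump trial function on `[−2π, 2π]` with NEGATIVE one-surface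
energy (`SAlpha.UnstableWitness s α (−2π) (2π) ttX ttX′`) — i.e. the closed polygon with lower vertices `(1/2, 1/2)`, `(1, 17/25)`, `(3/2, 39/40)`,
`(2, 27/20)`, `(5/2, 7/4)`, `(3, 11/5)` and upper edge `α = 22/25 + (31/25)s` lies in the MODEL's unstable set; in particular, UNIFORMLY in
`s ∈ [1/2, 3]`, the unstable `α`-set `U_s` contains the whole interval `[lensLo s, lensHi s]`, so wherever a stable surface `(s, α₋)` with
`α₋ < lensLo s` is certified (today: the eight shears of `SAlphaFirstStabilityBrackets`, BY NAME) the first-stability edge above `α₋` is `≤ lensLo s`;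
between the eight shears this is the ONLY certified upper information on the edge.  Pointwise the lens is weaker than the shear rows
(`lensLo = 0.5, 0.59, 0.68, 0.8275, 0.975, 1.35, 1.75, 2.2` at `s = 1/2, 3/4, 1, 5/4, 3/2, 2, 5/2, 3` against the row ends
`1/2, 23/40, 31/50, 33/40, 19/20, 5/4, 13/8–7/4, 19/10–11/5`); its content is the quantifier over `s`.  VALIDATED (not in the kernel): the
worst-case conic's own negative lens is `r₁(s) < α < r₂(s)` with `r₁ ≈ 0.481, 0.666, 0.968, 1.330, 1.734, 2.173` and `r₂ ≈ 1.561, 2.336, 2.995,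
3.594, 4.151, 4.674` at `s = 1/2, 1, 3/2, 2, 5/2, 3` (floats); E–L shooting edges `0.395, 0.615, 0.885, 1.18, 1.49, 1.815` (lit-4 kit j299948 /
j301608); the printed fit `α ≈ 0.6 s` (12.100).  MODELLED: `s–α` model (large-aspect-ratio shifted circles, high-`n` ballooning ordering,
`θ₀ = 0`, ideal MHD); «unstable» = the MODEL's one-surface energy admits a negative compactly supported trial function (lit-3's witness class;
representation step `W̄ < 0 ⇒ δW < 0`, Connor–Hastie–Taylor 1979, quoted in the Literature file, NOT typed); the upper edge `lensHi` is the
conic's own limit, NOT the model's second-stability boundary; no device, no `β`-limit.  Citations: Freidberg 2014 §12.3 (12.38)–(12.40),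
§12.6.2 (12.96)–(12.100), Fig. 12.5 [Freidberg2014].  Everything here is [instance data].
-/

noncomputable section

open Real Set
open Literature.MathematicalPhysics.MHD.Ballooning

namespace Summit.Ventures.FusionMHD.Models

namespace SAlphaTwoTurnLens

open SAlphaTwoTurnBump

/-! ### §1 A rational upper model of the conic on the quadrant `s, α ≥ 0` -/

/-- The two-turn conic with every coefficient at the UNFAVOURABLE rational end of its bracket of record
(`e₁ < 1584839`, `e₂ < 3537470`, `e₃ < −6326027`, `e₄ < 3291340`, `e₅ < −3556089`). [instance data] -/
def ttConicHi (s α : ℝ) : ℝ :=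
  1584839 + 3537470 * s ^ 2 - 6326027 * s * α + 3291340 * α ^ 2 - 3556089 * α

/-- On the quadrant `s, α ≥ 0` the conic is below its rational upper model. [instance data] -/
theorem ttConic_le_ttConicHi {s α : ℝ} (hs : 0 ≤ s) (hα : 0 ≤ α) : ttConic s α ≤ ttConicHi s α := by
  have h1 := tte1_bounds; have h2 := tte2_bounds; have h3 := tte3_bounds; have h4 := tte4_bounds; have h5 := tte5_bounds
  have e : ttConicHi s α - ttConic s α = (1584839 - tte1) + (3537470 - tte2) * s ^ 2 + (-6326027 - tte3) * (s * α)
      + (3291340 - tte4) * α ^ 2 + (-3556089 - tte5) * α := by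
    unfold ttConic ttConicHi; ring
  have a1 : 0 ≤ 1584839 - tte1 := by linarith [h1.2]
  have a2 : 0 ≤ (3537470 - tte2) * s ^ 2 := mul_nonneg (by linarith [h2.2]) (sq_nonneg s)
  have a3 : 0 ≤ (-6326027 - tte3) * (s * α) := mul_nonneg (by linarith [h3.2]) (mul_nonneg hs hα)
  have a4 : 0 ≤ (3291340 - tte4) * α ^ 2 := mul_nonneg (by linarith [h4.2]) (sq_nonneg α)
  have a5 : 0 ≤ (-3556089 - tte5) * α := mul_nonneg (by linarith [h5.2]) hα
  linarith

/-! ### §2 Chord identities: negativity on a quadrilateral from its corners -/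

/-- CHORD IN `α` at fixed `s`: the upper model is a convex parabola in `α` (leading coefficient `3291340`), so on a segment
`[lo, hi]` it is negative as soon as it is negative at both ends. [instance data] -/
theorem ttConicHi_neg_of_between {s lo hi α : ℝ} (hlt : lo < hi) (h1 : lo ≤ α) (h2 : α ≤ hi)
    (hlo : ttConicHi s lo < 0) (hhi : ttConicHi s hi < 0) : ttConicHi s α < 0 := by
  have e : (hi - lo) * ttConicHi s α
      = 3291340 * (hi - lo) * ((α - lo) * (α - hi)) + (hi - α) * ttConicHi s lo + (α - lo) * ttConicHi s hi := by
    unfold ttConicHi; ring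
  have p0 : 3291340 * (hi - lo) * ((α - lo) * (α - hi)) ≤ 0 := by
    have : (α - lo) * (α - hi) ≤ 0 := mul_nonpos_of_nonneg_of_nonpos (by linarith) (by linarith)
    have hpos : (0 : ℝ) ≤ 3291340 * (hi - lo) := by positivity
    exact mul_nonpos_of_nonneg_of_nonpos (by linarith) this
  have p1 : (hi - α) * ttConicHi s lo ≤ (hi - α) * 0 := mul_le_mul_of_nonneg_left hlo.le (by linarith)
  have p2 : (α - lo) * ttConicHi s hi ≤ (α - lo) * 0 := mul_le_mul_of_nonneg_left hhi.le (by linarith)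
  -- at least one of the two end weights is positive, and both end values are negative
  have p12 : (hi - α) * ttConicHi s lo + (α - lo) * ttConicHi s hi < 0 := by
    rcases eq_or_lt_of_le h2 with hα | hα
    · have : (α - lo) * ttConicHi s hi < 0 := mul_neg_of_pos_of_neg (by rw [hα]; linarith) hhi
      linarith
    · have : (hi - α) * ttConicHi s lo < 0 := mul_neg_of_pos_of_neg (by linarith) hlo
      linarith
  have hprod : (hi - lo) * ttConicHi s α < 0 := by linarith
  by_contra hcon
  have : 0 ≤ (hi - lo) * ttConicHi s α := mul_nonneg (by linarith) (not_lt.1 hcon)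
  linarith

/-- CHORD IN `s` along the line `α = p + q s`: the upper model restricted to the line is a parabola in `s` with leading
coefficient `3537470 − 6326027 q + 3291340 q²`; when that is `≥ 0` (it is for every real `q`; we check it per slope), negativity on
`[s₁, s₂]` follows from negativity at the two ends. [instance data] -/
theorem ttConicHi_neg_on_line {p q s₁ s₂ s : ℝ} (hA : 0 ≤ 3537470 - 6326027 * q + 3291340 * q ^ 2) (hlt : s₁ < s₂)
    (h1 : s₁ ≤ s) (h2 : s ≤ s₂) (hQ1 : ttConicHi s₁ (p + q * s₁) < 0) (hQ2 : ttConicHi s₂ (p + q * s₂) < 0) :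
    ttConicHi s (p + q * s) < 0 := by
  have e : (s₂ - s₁) * ttConicHi s (p + q * s)
      = (3537470 - 6326027 * q + 3291340 * q ^ 2) * (s₂ - s₁) * ((s - s₁) * (s - s₂))
        + (s₂ - s) * ttConicHi s₁ (p + q * s₁) + (s - s₁) * ttConicHi s₂ (p + q * s₂) := by
    unfold ttConicHi; ring
  have p0 : (3537470 - 6326027 * q + 3291340 * q ^ 2) * (s₂ - s₁) * ((s - s₁) * (s - s₂)) ≤ 0 := by
    have : (s - s₁) * (s - s₂) ≤ 0 := mul_nonpos_of_nonneg_of_nonpos (by linarith) (by linarith)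
    exact mul_nonpos_of_nonneg_of_nonpos (mul_nonneg hA (by linarith)) this
  have p12 : (s₂ - s) * ttConicHi s₁ (p + q * s₁) + (s - s₁) * ttConicHi s₂ (p + q * s₂) < 0 := by
    rcases eq_or_lt_of_le h2 with hs | hs
    · have : (s - s₁) * ttConicHi s₂ (p + q * s₂) < 0 := mul_neg_of_pos_of_neg (by rw [hs]; linarith) hQ2
      have : (s₂ - s) * ttConicHi s₁ (p + q * s₁) ≤ (s₂ - s) * 0 := mul_le_mul_of_nonneg_left hQ1.le (by linarith)
      linarith
    · have : (s₂ - s) * ttConicHi s₁ (p + q * s₁) < 0 := mul_neg_of_pos_of_neg (by linarith) hQ1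
      have : (s - s₁) * ttConicHi s₂ (p + q * s₂) ≤ (s - s₁) * 0 := mul_le_mul_of_nonneg_left hQ2.le (by linarith)
      linarith
  have hprod : (s₂ - s₁) * ttConicHi s (p + q * s) < 0 := by linarith
  by_contra hcon
  have : 0 ≤ (s₂ - s₁) * ttConicHi s (p + q * s) := mul_nonneg (by linarith) (not_lt.1 hcon)
  linarith

/-- THE QUADRILATERAL LEMMA: on `s ∈ [s₁, s₂]` between the lines `α = p + q s` (lower) and `α = p' + q' s` (upper, above the lower one),
the conic is negative as soon as the upper model is negative at the FOUR CORNERS. [instance data] -/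
theorem ttConic_neg_of_corners {p q p' q' s₁ s₂ s α : ℝ} (hs₁ : 0 ≤ s₁) (hlt : s₁ < s₂)
    (hA : 0 ≤ 3537470 - 6326027 * q + 3291340 * q ^ 2) (hA' : 0 ≤ 3537470 - 6326027 * q' + 3291340 * q' ^ 2)
    (hsep : ∀ t, s₁ ≤ t → t ≤ s₂ → p + q * t < p' + q' * t) (hlo0 : ∀ t, s₁ ≤ t → t ≤ s₂ → 0 ≤ p + q * t)
    (c1 : ttConicHi s₁ (p + q * s₁) < 0) (c2 : ttConicHi s₂ (p + q * s₂) < 0)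
    (c3 : ttConicHi s₁ (p' + q' * s₁) < 0) (c4 : ttConicHi s₂ (p' + q' * s₂) < 0)
    (h1 : s₁ ≤ s) (h2 : s ≤ s₂) (h3 : p + q * s ≤ α) (h4 : α ≤ p' + q' * s) : ttConic s α < 0 := by
  have hs : 0 ≤ s := hs₁.trans h1
  have hα : 0 ≤ α := (hlo0 s h1 h2).trans h3
  have hL : ttConicHi s (p + q * s) < 0 := ttConicHi_neg_on_line hA hlt h1 h2 c1 c2
  have hU : ttConicHi s (p' + q' * s) < 0 := ttConicHi_neg_on_line hA' hlt h1 h2 c3 c4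
  have hM : ttConicHi s α < 0 := ttConicHi_neg_of_between (hsep s h1 h2) h3 h4 hL hU
  exact lt_of_le_of_lt (ttConic_le_ttConicHi hs hα) hM

/-! ### §3 The polygon -/

/-- THE LOWER POLYLINE through `(1/2, 1/2)`, `(1, 17/25)`, `(3/2, 39/40)`, `(2, 27/20)`, `(5/2, 7/4)`, `(3, 11/5)`, written as the maximum of
its five chords (the vertex data are convex, so on `[1/2, 3]` the maximum IS the piecewise-linear interpolant). [instance data] -/
def lensLo (s : ℝ) : ℝ :=
  max (max (max (max (8 / 25 + 9 / 25 * s) (9 / 100 + 59 / 100 * s)) (-3 / 20 + 3 / 4 * s)) (-1 / 4 + 4 / 5 * s))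
    (-1 / 2 + 9 / 10 * s)

/-- THE UPPER LINE `α = 22/25 + (31/25) s` (through `(1/2, 3/2)` and `(3, 23/5)`, below the conic's upper branch). [instance data] -/
def lensHi (s : ℝ) : ℝ := 22 / 25 + 31 / 25 * s

/-- PIECE 1, `s ∈ [1/2, 1]`: between the chord `8/25 + (9/25)s` and the upper line the conic is negative. [instance data] -/
theorem ttConic_neg_piece1 {s α : ℝ} (h1 : 1 / 2 ≤ s) (h2 : s ≤ 1) (h3 : 8 / 25 + 9 / 25 * s ≤ α)
    (h4 : α ≤ 22 / 25 + 31 / 25 * s) : ttConic s α < 0 :=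
  ttConic_neg_of_corners (p := 8 / 25) (q := 9 / 25) (p' := 22 / 25) (q' := 31 / 25) (s₁ := 1 / 2) (s₂ := 1)
    (by norm_num) (by norm_num) (by norm_num) (by norm_num)
    (fun t ht _ => by linarith) (fun t ht _ => by linarith)
    (by norm_num [ttConicHi]) (by norm_num [ttConicHi]) (by norm_num [ttConicHi]) (by norm_num [ttConicHi]) h1 h2 h3 h4

/-- PIECE 2, `s ∈ [1, 3/2]`: between the chord `9/100 + (59/100)s` and the upper line the conic is negative. [instance data] -/
theorem ttConic_neg_piece2 {s α : ℝ} (h1 : 1 ≤ s) (h2 : s ≤ 3 / 2) (h3 : 9 / 100 + 59 / 100 * s ≤ α)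
    (h4 : α ≤ 22 / 25 + 31 / 25 * s) : ttConic s α < 0 :=
  ttConic_neg_of_corners (p := 9 / 100) (q := 59 / 100) (p' := 22 / 25) (q' := 31 / 25) (s₁ := 1) (s₂ := 3 / 2)
    (by norm_num) (by norm_num) (by norm_num) (by norm_num)
    (fun t ht _ => by linarith) (fun t ht _ => by linarith)
    (by norm_num [ttConicHi]) (by norm_num [ttConicHi]) (by norm_num [ttConicHi]) (by norm_num [ttConicHi]) h1 h2 h3 h4

/-- PIECE 3, `s ∈ [3/2, 2]`: between the chord `−3/20 + (3/4)s` and the upper line the conic is negative. [instance data] -/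
theorem ttConic_neg_piece3 {s α : ℝ} (h1 : 3 / 2 ≤ s) (h2 : s ≤ 2) (h3 : -3 / 20 + 3 / 4 * s ≤ α)
    (h4 : α ≤ 22 / 25 + 31 / 25 * s) : ttConic s α < 0 :=
  ttConic_neg_of_corners (p := -3 / 20) (q := 3 / 4) (p' := 22 / 25) (q' := 31 / 25) (s₁ := 3 / 2) (s₂ := 2)
    (by norm_num) (by norm_num) (by norm_num) (by norm_num)
    (fun t ht _ => by linarith) (fun t ht _ => by linarith)
    (by norm_num [ttConicHi]) (by norm_num [ttConicHi]) (by norm_num [ttConicHi]) (by norm_num [ttConicHi]) h1 h2 h3 h4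

/-- PIECE 4, `s ∈ [2, 5/2]`: between the chord `−1/4 + (4/5)s` and the upper line the conic is negative. [instance data] -/
theorem ttConic_neg_piece4 {s α : ℝ} (h1 : 2 ≤ s) (h2 : s ≤ 5 / 2) (h3 : -1 / 4 + 4 / 5 * s ≤ α)
    (h4 : α ≤ 22 / 25 + 31 / 25 * s) : ttConic s α < 0 :=
  ttConic_neg_of_corners (p := -1 / 4) (q := 4 / 5) (p' := 22 / 25) (q' := 31 / 25) (s₁ := 2) (s₂ := 5 / 2)
    (by norm_num) (by norm_num) (by norm_num) (by norm_num)
    (fun t ht _ => by linarith) (fun t ht _ => by linarith)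
    (by norm_num [ttConicHi]) (by norm_num [ttConicHi]) (by norm_num [ttConicHi]) (by norm_num [ttConicHi]) h1 h2 h3 h4

/-- PIECE 5, `s ∈ [5/2, 3]`: between the chord `−1/2 + (9/10)s` and the upper line the conic is negative. [instance data] -/
theorem ttConic_neg_piece5 {s α : ℝ} (h1 : 5 / 2 ≤ s) (h2 : s ≤ 3) (h3 : -1 / 2 + 9 / 10 * s ≤ α)
    (h4 : α ≤ 22 / 25 + 31 / 25 * s) : ttConic s α < 0 :=
  ttConic_neg_of_corners (p := -1 / 2) (q := 9 / 10) (p' := 22 / 25) (q' := 31 / 25) (s₁ := 5 / 2) (s₂ := 3)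
    (by norm_num) (by norm_num) (by norm_num) (by norm_num)
    (fun t ht _ => by linarith) (fun t ht _ => by linarith)
    (by norm_num [ttConicHi]) (by norm_num [ttConicHi]) (by norm_num [ttConicHi]) (by norm_num [ttConicHi]) h1 h2 h3 h4

/-- THE CONIC IS NEGATIVE ON THE WHOLE POLYGON `1/2 ≤ s ≤ 3`, `lensLo s ≤ α ≤ lensHi s`. [instance data] -/
theorem ttConic_neg_of_mem_lens {s α : ℝ} (h1 : 1 / 2 ≤ s) (h2 : s ≤ 3) (h3 : lensLo s ≤ α) (h4 : α ≤ lensHi s) :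
    ttConic s α < 0 := by
  unfold lensHi at h4
  unfold lensLo at h3
  have l5 : -1 / 2 + 9 / 10 * s ≤ α := (le_max_right _ _).trans h3
  have l4 : -1 / 4 + 4 / 5 * s ≤ α := ((le_max_right _ _).trans (le_max_left _ _)).trans h3
  have l3 : -3 / 20 + 3 / 4 * s ≤ α := ((le_max_right _ _).trans ((le_max_left _ _).trans (le_max_left _ _))).trans h3
  have l2 : 9 / 100 + 59 / 100 * s ≤ α :=
    ((le_max_right _ _).trans ((le_max_left _ _).trans ((le_max_left _ _).trans (le_max_left _ _)))).trans h3
  have l1 : 8 / 25 + 9 / 25 * s ≤ α :=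
    ((le_max_left _ _).trans ((le_max_left _ _).trans ((le_max_left _ _).trans (le_max_left _ _)))).trans h3
  rcases le_total s 1 with hs1 | hs1
  · exact ttConic_neg_piece1 h1 hs1 l1 h4
  rcases le_total s (3 / 2) with hs2 | hs2
  · exact ttConic_neg_piece2 hs1 hs2 l2 h4
  rcases le_total s 2 with hs3 | hs3
  · exact ttConic_neg_piece3 hs2 hs3 l3 h4
  rcases le_total s (5 / 2) with hs4 | hs4
  · exact ttConic_neg_piece4 hs3 hs4 l4 h4
  · exact ttConic_neg_piece5 hs4 h2 l5 h4

/-- The lower polyline is below the upper line on `[1/2, 3]` (indeed for every `s ≥ 0`). [instance data] -/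
theorem lensLo_le_lensHi {s : ℝ} (hs : 0 ≤ s) : lensLo s ≤ lensHi s := by
  unfold lensLo lensHi
  refine max_le (max_le (max_le (max_le ?_ ?_) ?_) ?_) ?_ <;> linarith

/-- **THE LENS, UNIFORM IN THE SHEAR**: for EVERY `s ∈ [1/2, 3]` and every `α ∈ [lensLo s, lensHi s]` the surface `(s, α)` of the `s–α`
MODEL carries model-7's two-turn-bump trial function on `[−2π, 2π]` with negative one-surface energy.  MODEL statement; «unstable» in the
model's own one-surface (trial-function) sense; nothing about a device. [instance data] -/
theorem unstableWitness_of_mem_lens {s α : ℝ} (h1 : 1 / 2 ≤ s) (h2 : s ≤ 3) (h3 : lensLo s ≤ α) (h4 : α ≤ lensHi s) :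
    SAlpha.UnstableWitness s α (-(2 * π)) (2 * π) ttX ttX' :=
  unstableWitness_of_ttConic_neg (ttConic_neg_of_mem_lens h1 h2 h3 h4)

/-- **ALONG THE LOWER POLYLINE**: for every `s ∈ [1/2, 3]` the surface `(s, lensLo s)` is on the unstable side of the MODEL — a
certified-unstable CURVE `s ↦ (s, lensLo s)` lying above the first-stability boundary uniformly in `s` (vertices `(1/2, 1/2)`, `(1, 17/25)`,
`(3/2, 39/40)`, `(2, 27/20)`, `(5/2, 7/4)`, `(3, 11/5)`).  MODEL statement; no device. [instance data] -/
theorem unstableWitness_along_lensLo {s : ℝ} (h1 : 1 / 2 ≤ s) (h2 : s ≤ 3) :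
    SAlpha.UnstableWitness s (lensLo s) (-(2 * π)) (2 * π) ttX ttX' :=
  unstableWitness_of_mem_lens h1 h2 le_rfl (lensLo_le_lensHi (by linarith))

/-- The same with the polygon read as a set: every point of
`{(s, α) | 1/2 ≤ s ≤ 3 ∧ lensLo s ≤ α ≤ lensHi s}` is a certified-unstable surface of the MODEL. [instance data] -/
theorem unstableWitness_on_polygon :
    ∀ p ∈ {p : ℝ × ℝ | 1 / 2 ≤ p.1 ∧ p.1 ≤ 3 ∧ lensLo p.1 ≤ p.2 ∧ p.2 ≤ lensHi p.1},
      SAlpha.UnstableWitness p.1 p.2 (-(2 * π)) (2 * π) ttX ttX' := by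
  rintro ⟨s, α⟩ ⟨h1, h2, h3, h4⟩
  exact unstableWitness_of_mem_lens h1 h2 h3 h4

/-- Values of the lower polyline at the eight shears of the ladder: `1/2, 59/100, 17/25, 331/400, 39/40, 27/20, 7/4, 11/5` at
`s = 1/2, 3/4, 1, 5/4, 3/2, 2, 5/2, 3`. [instance data] -/
theorem lensLo_at_shears :
    lensLo (1 / 2) = 1 / 2 ∧ lensLo (3 / 4) = 59 / 100 ∧ lensLo 1 = 17 / 25 ∧ lensLo (5 / 4) = 331 / 400 ∧
      lensLo (3 / 2) = 39 / 40 ∧ lensLo 2 = 27 / 20 ∧ lensLo (5 / 2) = 7 / 4 ∧ lensLo 3 = 11 / 5 := by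
  unfold lensLo
  refine ⟨?_, ?_, ?_, ?_, ?_, ?_, ?_, ?_⟩ <;> norm_num [max_def_lt]

end SAlphaTwoTurnLens

end Summit.Ventures.FusionMHD.Models

end
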